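import Literature.AlgebraicGeometry.AbelianSchemes.AbelianSchemeOverBase
import HarnessLib

/-!
# Being a homomorphism of group schemes is Zariski-local on the base

[GortzWedhorn2020, Section (4.15) (p. 116), Def. 4.42]: a homomorphism of `S`-group schemes is an `S`-morphism
inducing group homomorphisms on points; base change along `S' → S` takes group schemes to group schemes and
homomorphisms to homomorphisms («`(G ×_S S')_{S'}(T) = G_S(T)`»).  THIS FILE proves the CONVERSE along an open cover:
for abelian schemes `A`, `B` over `S` (the tree's ★ `AbelianSchemeOver`, with `A.baseChange g` carrying the transported
group structure, Mathlib `Functor.grpObjObj` for the cartesian-monoidal functor `Over.pullback g`) and an `S`-morphism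
`Λ : A.X ⟶ B.X`:

* `hom_ext_pullback_openCover` — the base-change functors `Over.pullback (𝒰.f k)` for an open cover `𝒰` of `S` are
  JOINTLY FAITHFUL on `Over S` (Mathlib `Scheme.Cover.hom_ext` on the cover `X ×_S U_k` of `X`);
* **`isMonHom_of_openCover`** — if every base change `Λ ×_S U_k : A ×_S U_k → B ×_S U_k` is a homomorphism
  (Mathlib `IsMonHom`, for the transported structures), then `Λ` is a homomorphism: the unit and multiplication
  clauses are tested after each monoidal functor `Over.pullback (𝒰.f k)`, whose structure isomorphisms `ε`, `μ` cancel
  (Mathlib `Functor.obj.η_def`, `Functor.obj.μ_def`, `Functor.LaxMonoidal.μ_natural`).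

Cell hodgecm-mathlib, F-DAG hand (h7) «Zariski gluing of `S`-objects from a cocycle», FILE 8a; consumer: FILE 8b
(homomorphisms out of a glued abelian scheme) and the polarisation layer (P) (the glued `λ : A → Â` is a
homomorphism because it is one on every chart).  Theorems only; no named fact, no `sorry`, no instance.  HC_CM is proved
only modulo the printed citations until rung 0 closes; this file discharges none of them.

## References
* [GortzWedhorn2020] U. Görtz, T. Wedhorn, *Algebraic Geometry I*, 2nd ed. (2020), Section (3.3) Prop. 3.5 (gluing of
  morphisms), Section (4.15) (p. 116) (group schemes, base change), Def. 4.42 (p. 116) (homomorphisms).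
-/

noncomputable section

universe u

open CategoryTheory CategoryTheory.Limits AlgebraicGeometry MonoidalCategory CartesianMonoidalCategory
open scoped MonObj CategoryTheory.Obj

namespace Literature.AlgebraicGeometry.AbelianSchemes

namespace AbelianSchemeOver

variable {S : Scheme.{u}}

/-- **The base changes to the members of an open cover of `S` are jointly faithful on `S`-schemes**: two
`S`-morphisms `u v : X → Y` with `u ×_S U_k = v ×_S U_k` for all `k` are equal (they agree on the open cover
`X ×_S U_k` of `X`; [GortzWedhorn2020] Prop. 3.5). [cite: GortzWedhorn2020, Section (3.3) Proposition 3.5] -/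
theorem hom_ext_pullback_openCover (𝒰 : S.OpenCover) {X Y : Over S} (u v : X ⟶ Y)
    (h : ∀ k, (Over.pullback (𝒰.f k)).map u = (Over.pullback (𝒰.f k)).map v) : u = v := by
  ext
  refine Scheme.Cover.hom_ext (𝒰.pullback₁ X.hom) _ _ fun (k : 𝒰.I₀) => ?_
  have e := congrArg (fun w => w.left ≫ pullback.fst Y.hom (𝒰.f k)) (h k)
  simp only [Over.pullback_map_left] at e
  erw [pullback.lift_fst, pullback.lift_fst] at e
  exact e

variable (A B : AbelianSchemeOver S) (𝒰 : S.OpenCover) (Λ : A.X ⟶ B.X)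

/-- **Being a homomorphism of group schemes is Zariski-local on the base**: if every base change
`Λ ×_S U_k : A ×_S U_k → B ×_S U_k` to a member of an open cover of `S` is a homomorphism (for the transported
group-scheme structures of ★ `AbelianSchemeOver.baseChange` = Mathlib `Functor.grpObjObj`), then so is `Λ : A → B`
([GortzWedhorn2020] Section (4.15): homomorphisms are detected on points, and «`(G ×_S S')_{S'}(T) = G_S(T)`»).
[cite: GortzWedhorn2020, Section (4.15) (p. 116) and Definition 4.42 (p. 116)] -/
theorem isMonHom_of_openCover
    (h : ∀ k, IsMonHom ((Over.pullback (𝒰.f k)).map Λ : (A.baseChange (𝒰.f k)).X ⟶ (B.baseChange (𝒰.f k)).X)) :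
    IsMonHom Λ where
  one_hom := by
    refine hom_ext_pullback_openCover 𝒰 _ _ fun k => ?_
    have e := (h k).one_hom
    rw [Functor.obj.η_def, Functor.obj.η_def, Category.assoc, ← Functor.map_comp] at e
    exact (cancel_epi _).mp e
  mul_hom := by
    refine hom_ext_pullback_openCover 𝒰 _ _ fun k => ?_
    have e := (h k).mul_hom
    rw [Functor.obj.μ_def, Functor.obj.μ_def, Category.assoc, Functor.LaxMonoidal.μ_natural_assoc,
      ← Functor.map_comp, ← Functor.map_comp] at e
    exact (cancel_epi _).mp e

end AbelianSchemeOver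

end Literature.AlgebraicGeometry.AbelianSchemes

end
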